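import Literature.Computability.AlgebraicComplexity.Yab15BRank
import Literature.Computability.AlgebraicComplexity.MignonRessayreCharZero
import Literature.Analysis.Matrix.SylvesterInertiaCertificate
import HarnessLib

/-!
# Yabe 2015, Theorem 1.7 discharged: `dc(per_d) ≥ (d−1)² + 1` over `ℝ`

Companion of `Yab15BRank.lean` (val-lit cell, seat t17). A. Yabe, *Bi-polynomial rank and
determinantal complexity*, arXiv:1504.00151, **Theorem 1.7** (p0003): "Over the field `ℝ`, it holds
that `dc(perm_d) ≥ (d−1)² + 1`", typed there as the named fact `yabe2015_thm_1_7`; this file proves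
`yabe2015_thm_1_7_holds : yabe2015_thm_1_7`. Honest framing: a kernel-checked version of a published
real lower bound; `VP ≠ VNP` is NOT proved and nothing here is progress on it; the bound concerns
determinantal representations with REAL affine entries only (over `ℂ` the record stays `d²/2`).

## The printed proof and the route taken here

Yabe (§3.2, p0008–p0009): `dc(perm_d) ≥ brank(perm^{(2)}_{d,Σ_d}) = rank Q_opt ≥ n₋` (Thm. 1.5 with
`k = 1`, Thm. 2.1, Lemma 3.1), and the signature of the Hessian `H = H_{per_d,Σ_d}` at the
Mignon–Ressayre zero `Σ_d` is `(2d−2, (d−1)²+1, 0)`, computed from an explicit congruence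
`T H Tᵀ = diag(S_{d−1} ⊗ B, −((d−1)/(d−2))·C B⁻¹ C)`.

* The first half is the tree's **signature engine** `yabe2015_signature_le_determinantalComplexity`
  (`Yab15BRank.lean`): at every real zero `x₀` of `p`, `max(n₊, n₋)(H_{p,x₀}) ≤ dc(p)`.
* The second half is proved here by an EXPLICIT NEGATIVE-DEFINITE SUBSPACE of dimension `(d−1)² + 1`
  instead of the printed congruence (same count; the eigenvectors themselves are irrational, the
  subspace is rational). In the tree's coordinates (`d = m+3`, exceptional index `0`, Hessian
  `= m!·mrHess`, `mrHess` entries `0 / (m+1) / −2`, `HessianAtOrigin.lean`): the test vectors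
  `Z(M₀, v, w, s, t)` (`YabeReal.negZ`) with `M₀` an `(m+2) × (m+2)` block of zero row/column sums,
  `v, w ∈ ℝ^{m+2}` of sum zero, `s, t ∈ ℝ` satisfy
  `Zᵀ·mrHess·Z = −2‖M₀‖² − 2(m+1)(m+2)(‖v‖²+‖w‖²) − 2(m+1)(m+2)³s² − 2(m+1)(m+2)²t²`
  (`YabeReal.negZ_dotProduct_mrHess_mulVec_negZ`, from the closed form of `mrHess·Z`), so the frame
  `YabeReal.frameLin` (free parameters: an `(m+1)²` block, two `(m+1)`-vectors, `s`, `t`; dimension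
  `(m+2)² + 1 = (d−1)² + 1`) is negative definite, and Courant–Fischer counting
  (`Literature.Analysis.Matrix.EigenvalueCount.card_le_card_eigenvalues_lt`) gives
  `n₋(H) ≥ (d−1)² + 1`. (Why these vectors: the form is invariant under `S_{d−1} × S_{d−1}` permuting
  the non-exceptional rows and columns; the zero-margin block is the `std ⊗ std` isotypic component, on
  which `mrHess = −2`; `v`, `w` pick the negative direction of the two `2 × 2` `std`-blocks and `s`, `t`
  a negative plane of the `4 × 4` trivial block of signature `(2,2)`.) The identities were
  cross-checked in exact rational arithmetic for `d = 3, …, 6` before formalisation.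
* `d = 1, 2`: the degree bound `d ≤ dc(per_d)` (`card_le_determinantalComplexity_perPoly`).

## Contents

* `YabeReal.negZ`, `YabeReal.padVec`, `YabeReal.padMat`, `YabeReal.FrameIdx`, `YabeReal.frameFun`,
  `YabeReal.frameLin` — the test vectors and their injective linear parametrisation (plumbing defs);
* `YabeReal.mrHess_mulVec_negZ_*` — `mrHess·Z` in closed form; `YabeReal.negZ_dotProduct_mrHess_mulVec_negZ`
  — the sum-of-squares identity; `YabeReal.frame_neg` — negative definiteness on the frame;
* `YabeReal.card_neg_eigenvalues_smul_mrHess` — `n₋(a·mrHess) ≥ (m+2)² + 1` (`a > 0`);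
* `hessianMatrix_perPoly_mrPoint` — `H_{per_{m+3}, mrPoint} = m!·mrHess` as matrices;
* `yabe2015_thm_1_7_holds` — the discharge.

No new definitions of mathematical notions, no named facts, no instances, no notation.

## References

* [Yabe2015] A. Yabe, *Bi-polynomial rank and determinantal complexity*, arXiv:1504.00151, Thm. 1.7,
  §3.2 (held text `paper:arxiv-1504.00151`, chunks p0003, p0008–p0009).
* [LandsbergGCT2017] J. M. Landsberg, *Geometry and Complexity Theory*, CUP 2017, §6.4.6, (6.4.3)
  (the point `y₀` and the Hessian pattern; in tree `mrPoint`, `mrHess`, `hess0_transl_mrPoint_perPoly`).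
* [MignonRessayre2004] T. Mignon, N. Ressayre, IMRN 2004:79 (the bound `d²/2` being improved over `ℝ`).
* [HornJohnson2013] R. A. Horn, C. R. Johnson, *Matrix Analysis*, 2nd ed., (4.2.12) (Courant–Fischer
  counting, in tree `EigenvalueCount.card_le_card_eigenvalues_lt`).
-/

noncomputable section

open Matrix Finset MvPolynomial

namespace Literature.Computability.AlgebraicComplexity

namespace YabeReal

variable {m : ℕ}

/-- Split a sum over `Fin (m+3) × Fin (m+3)` by the exceptional index `0` in each coordinate. [folklore] -/
private theorem sum_prod_fin_succ (f : Fin (m + 3) × Fin (m + 3) → ℝ) :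
    ∑ p, f p = f (0, 0) + ∑ j : Fin (m + 2), f (0, j.succ) + ∑ i : Fin (m + 2), f (i.succ, 0) +
      ∑ i : Fin (m + 2), ∑ j : Fin (m + 2), f (i.succ, j.succ) := by
  rw [Fintype.sum_prod_type, Fin.sum_univ_succ, Fin.sum_univ_succ]
  simp only [Fin.sum_univ_succ, Finset.sum_add_distrib]
  ring

/-- `Σ_j [j ≠ j₀]·a·f j = a·Σ f − a·f j₀`. [folklore] -/
private theorem sum_ite_eq_zero (j₀ : Fin (m + 2)) (a : ℝ) (f : Fin (m + 2) → ℝ) :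
    ∑ j, (if j = j₀ then 0 else a) * f j = a * ∑ j, f j - a * f j₀ := by
  have h : ∀ j, (if j = j₀ then 0 else a) * f j = a * f j - (if j = j₀ then a * f j else 0) := by
    intro j; split_ifs <;> ring
  simp_rw [h]
  rw [Finset.sum_sub_distrib, Finset.mul_sum, Finset.sum_ite_eq']
  simp

/-- `Σ_i [i ≠ i₀]·F i = Σ F − F i₀`. [folklore] -/
private theorem sum_ite_zero_else (i₀ : Fin (m + 2)) (F : Fin (m + 2) → ℝ) :
    ∑ i, (if i = i₀ then 0 else F i) = ∑ i, F i - F i₀ := by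
  have h : ∀ i, (if i = i₀ then 0 else F i) = F i - (if i = i₀ then F i else 0) := by
    intro i; split_ifs <;> ring
  simp_rw [h]
  rw [Finset.sum_sub_distrib, Finset.sum_ite_eq']
  simp

/-- A double sum with one row and one column weight removed. [folklore] -/
private theorem sum_sum_ite_or_eq_zero (i₀ j₀ : Fin (m + 2)) (a : ℝ) (g : Fin (m + 2) → Fin (m + 2) → ℝ) :
    ∑ i, ∑ j, (if i = i₀ ∨ j = j₀ then 0 else a) * g i j =
      a * ∑ i, ∑ j, g i j - a * ∑ j, g i₀ j - a * ∑ i, g i j₀ + a * g i₀ j₀ := by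
  have hinner : ∀ i, ∑ j, (if i = i₀ ∨ j = j₀ then 0 else a) * g i j =
      if i = i₀ then 0 else (a * ∑ j, g i j - a * g i j₀) := by
    intro i
    by_cases hi : i = i₀
    · rw [if_pos hi]
      exact Finset.sum_eq_zero fun j _ => by rw [if_pos (Or.inl hi), zero_mul]
    · rw [if_neg hi, ← sum_ite_eq_zero j₀ a (g i)]
      exact Finset.sum_congr rfl fun j _ => by simp [hi]
  simp_rw [hinner]
  rw [sum_ite_zero_else, Finset.sum_sub_distrib, Finset.mul_sum, Finset.mul_sum, Finset.mul_sum]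
  ring


/-- The test vectors `Z(M₀, v, w, s, t) ∈ ℝ^{d×d}` (`d = m+3`, exceptional index `0` as in
`mrPoint`/`mrHess`) spanning a negative-definite subspace of the Hessian of `per_d` at the
Mignon–Ressayre point: `Z(0,0) = −s`, `Z(0,j+1) = 2v_j + t`, `Z(i+1,0) = 2w_i − t`,
`Z(i+1,j+1) = M₀ᵢⱼ + v_j + w_i + s`. With `M₀` of zero row/column sums and `Σv = Σw = 0` these are the
negative directions of the four `S_{d−1} × S_{d−1}`-isotypic blocks of the Hessian form (Yabe 2015,
§3.2, proves `n₋ = (d−1)²+1` by an explicit congruence `T H Tᵀ`; this is an equivalent explicit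
negative subspace of that dimension). [cite: Yabe2015, §3.2 (proof of Theorem 1.7)] -/
def negZ (M₀ : Fin (m + 2) → Fin (m + 2) → ℝ) (v w : Fin (m + 2) → ℝ) (s t : ℝ) :
    Fin (m + 3) × Fin (m + 3) → ℝ := fun p =>
  Fin.cases (motive := fun _ => ℝ) (Fin.cases (motive := fun _ => ℝ) (-s) (fun j => 2 * v j + t) p.2)
    (fun i => Fin.cases (motive := fun _ => ℝ) (2 * w i - t) (fun j => M₀ i j + v j + w i + s) p.2) p.1

section Eval
variable (M₀ : Fin (m + 2) → Fin (m + 2) → ℝ) (v w : Fin (m + 2) → ℝ) (s t : ℝ)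

/-- Entry `(0,0)` of a test vector. [cite: Yabe2015, §3.2 (proof of Theorem 1.7)] -/
@[simp] theorem negZ_zero_zero : negZ M₀ v w s t (0, 0) = -s := rfl
/-- Entries of row `0` of a test vector. [cite: Yabe2015, §3.2 (proof of Theorem 1.7)] -/
@[simp] theorem negZ_zero_succ (j : Fin (m + 2)) : negZ M₀ v w s t (0, j.succ) = 2 * v j + t := by
  simp [negZ]
/-- Entries of column `0` of a test vector. [cite: Yabe2015, §3.2 (proof of Theorem 1.7)] -/
@[simp] theorem negZ_succ_zero (i : Fin (m + 2)) : negZ M₀ v w s t (i.succ, 0) = 2 * w i - t := by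
  simp [negZ]
/-- Inner entries of a test vector. [cite: Yabe2015, §3.2 (proof of Theorem 1.7)] -/
@[simp] theorem negZ_succ_succ (i j : Fin (m + 2)) :
    negZ M₀ v w s t (i.succ, j.succ) = M₀ i j + v j + w i + s := by
  simp [negZ]

/-- An entry of the Hessian pattern `mrHess` (Landsberg 2017, (6.4.3)), by position type relative to the
exceptional index `0`. [cite: LandsbergGCT2017, (6.4.3)] -/
private theorem mrHess_succ_succ_zero_zero (i₀ j₀ : Fin (m + 2)) :
    mrHess ℝ m (i₀.succ, j₀.succ) (0, 0) = (m : ℝ) + 1 := by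
  simp [mrHess_apply, (Fin.succ_ne_zero _).symm]
/-- An entry of the Hessian pattern `mrHess` (Landsberg 2017, (6.4.3)), by position type relative to the
exceptional index `0`. [cite: LandsbergGCT2017, (6.4.3)] -/
private theorem mrHess_succ_succ_zero_succ (i₀ j₀ j : Fin (m + 2)) :
    mrHess ℝ m (i₀.succ, j₀.succ) (0, j.succ) = if j = j₀ then 0 else (m : ℝ) + 1 := by
  simp [mrHess_apply, (Fin.succ_ne_zero _).symm, Fin.succ_inj]
/-- An entry of the Hessian pattern `mrHess` (Landsberg 2017, (6.4.3)), by position type relative to the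
exceptional index `0`. [cite: LandsbergGCT2017, (6.4.3)] -/
private theorem mrHess_succ_succ_succ_zero (i₀ j₀ i : Fin (m + 2)) :
    mrHess ℝ m (i₀.succ, j₀.succ) (i.succ, 0) = if i = i₀ then 0 else (m : ℝ) + 1 := by
  simp [mrHess_apply, (Fin.succ_ne_zero _).symm, Fin.succ_inj]
/-- An entry of the Hessian pattern `mrHess` (Landsberg 2017, (6.4.3)), by position type relative to the
exceptional index `0`. [cite: LandsbergGCT2017, (6.4.3)] -/
private theorem mrHess_succ_succ_succ_succ (i₀ j₀ i j : Fin (m + 2)) :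
    mrHess ℝ m (i₀.succ, j₀.succ) (i.succ, j.succ) = if i = i₀ ∨ j = j₀ then 0 else -2 := by
  simp [mrHess_apply, Fin.succ_ne_zero, Fin.succ_inj]

end Eval

/-- An entry of the Hessian pattern `mrHess` (Landsberg 2017, (6.4.3)), by position type relative to the
exceptional index `0`. [cite: LandsbergGCT2017, (6.4.3)] -/
private theorem mrHess_zero_succ_zero_zero (j₀ : Fin (m + 2)) : mrHess ℝ m (0, j₀.succ) (0, 0) = 0 := by
  simp [mrHess_apply]
/-- An entry of the Hessian pattern `mrHess` (Landsberg 2017, (6.4.3)), by position type relative to the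
exceptional index `0`. [cite: LandsbergGCT2017, (6.4.3)] -/
private theorem mrHess_zero_succ_zero_succ (j₀ j : Fin (m + 2)) : mrHess ℝ m (0, j₀.succ) (0, j.succ) = 0 := by
  simp [mrHess_apply]
/-- An entry of the Hessian pattern `mrHess` (Landsberg 2017, (6.4.3)), by position type relative to the
exceptional index `0`. [cite: LandsbergGCT2017, (6.4.3)] -/
private theorem mrHess_zero_succ_succ_zero (j₀ i : Fin (m + 2)) :
    mrHess ℝ m (0, j₀.succ) (i.succ, 0) = (m : ℝ) + 1 := by
  simp [mrHess_apply, Fin.succ_ne_zero, (Fin.succ_ne_zero _).symm]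
/-- An entry of the Hessian pattern `mrHess` (Landsberg 2017, (6.4.3)), by position type relative to the
exceptional index `0`. [cite: LandsbergGCT2017, (6.4.3)] -/
private theorem mrHess_zero_succ_succ_succ (j₀ i j : Fin (m + 2)) :
    mrHess ℝ m (0, j₀.succ) (i.succ, j.succ) = if j = j₀ then 0 else (m : ℝ) + 1 := by
  simp [mrHess_apply, Fin.succ_ne_zero, Fin.succ_inj]
/-- An entry of the Hessian pattern `mrHess` (Landsberg 2017, (6.4.3)), by position type relative to the
exceptional index `0`. [cite: LandsbergGCT2017, (6.4.3)] -/
private theorem mrHess_succ_zero_zero_zero (i₀ : Fin (m + 2)) : mrHess ℝ m (i₀.succ, 0) (0, 0) = 0 := by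
  simp [mrHess_apply]
/-- An entry of the Hessian pattern `mrHess` (Landsberg 2017, (6.4.3)), by position type relative to the
exceptional index `0`. [cite: LandsbergGCT2017, (6.4.3)] -/
private theorem mrHess_succ_zero_zero_succ (i₀ j : Fin (m + 2)) :
    mrHess ℝ m (i₀.succ, 0) (0, j.succ) = (m : ℝ) + 1 := by
  simp [mrHess_apply, Fin.succ_ne_zero, (Fin.succ_ne_zero _).symm]
/-- An entry of the Hessian pattern `mrHess` (Landsberg 2017, (6.4.3)), by position type relative to the
exceptional index `0`. [cite: LandsbergGCT2017, (6.4.3)] -/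
private theorem mrHess_succ_zero_succ_zero (i₀ i : Fin (m + 2)) : mrHess ℝ m (i₀.succ, 0) (i.succ, 0) = 0 := by
  simp [mrHess_apply]
/-- An entry of the Hessian pattern `mrHess` (Landsberg 2017, (6.4.3)), by position type relative to the
exceptional index `0`. [cite: LandsbergGCT2017, (6.4.3)] -/
private theorem mrHess_succ_zero_succ_succ (i₀ i j : Fin (m + 2)) :
    mrHess ℝ m (i₀.succ, 0) (i.succ, j.succ) = if i = i₀ then 0 else (m : ℝ) + 1 := by
  simp [mrHess_apply, Fin.succ_ne_zero, Fin.succ_inj]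
/-- An entry of the Hessian pattern `mrHess` (Landsberg 2017, (6.4.3)). [cite: LandsbergGCT2017, (6.4.3)] -/
private theorem mrHess_zero_zero_zero_zero : mrHess ℝ m (0, 0) (0, 0) = 0 := by simp [mrHess_apply]
/-- An entry of the Hessian pattern `mrHess` (Landsberg 2017, (6.4.3)), by position type relative to the
exceptional index `0`. [cite: LandsbergGCT2017, (6.4.3)] -/
private theorem mrHess_zero_zero_zero_succ (j : Fin (m + 2)) : mrHess ℝ m (0, 0) (0, j.succ) = 0 := by
  simp [mrHess_apply]
/-- An entry of the Hessian pattern `mrHess` (Landsberg 2017, (6.4.3)), by position type relative to the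
exceptional index `0`. [cite: LandsbergGCT2017, (6.4.3)] -/
private theorem mrHess_zero_zero_succ_zero (i : Fin (m + 2)) : mrHess ℝ m (0, 0) (i.succ, 0) = 0 := by
  simp [mrHess_apply]
/-- An entry of the Hessian pattern `mrHess` (Landsberg 2017, (6.4.3)), by position type relative to the
exceptional index `0`. [cite: LandsbergGCT2017, (6.4.3)] -/
private theorem mrHess_zero_zero_succ_succ (i j : Fin (m + 2)) :
    mrHess ℝ m (0, 0) (i.succ, j.succ) = (m : ℝ) + 1 := by
  simp [mrHess_apply, Fin.succ_ne_zero]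

/-! #### `mrHess *ᵥ Z` in closed form -/

section MulVec
variable {M₀ : Fin (m + 2) → Fin (m + 2) → ℝ} {v w : Fin (m + 2) → ℝ} {s t : ℝ}

/-- Row-`0` sum of a test vector: `Σ_j Z(0,j+1) = (m+2)t`. [cite: Yabe2015, §3.2 (proof of Theorem 1.7)] -/
private theorem sum_negZ_zero_succ (hv : ∑ j, v j = 0) :
    ∑ j : Fin (m + 2), negZ M₀ v w s t (0, j.succ) = ((m : ℝ) + 2) * t := by
  simp only [negZ_zero_succ, Finset.sum_add_distrib, ← Finset.mul_sum, hv, Finset.sum_const,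
    Finset.card_univ, Fintype.card_fin, nsmul_eq_mul]
  push_cast; ring

/-- Column-`0` sum of a test vector: `Σ_i Z(i+1,0) = −(m+2)t`. [cite: Yabe2015, §3.2 (proof of Theorem 1.7)] -/
private theorem sum_negZ_succ_zero (hw : ∑ i, w i = 0) :
    ∑ i : Fin (m + 2), negZ M₀ v w s t (i.succ, 0) = -(((m : ℝ) + 2) * t) := by
  simp only [negZ_succ_zero, Finset.sum_sub_distrib, ← Finset.mul_sum, hw, Finset.sum_const,
    Finset.card_univ, Fintype.card_fin, nsmul_eq_mul]
  push_cast; ring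

/-- Inner row sums of a test vector: `(m+2)(w_i + s)`. [cite: Yabe2015, §3.2 (proof of Theorem 1.7)] -/
private theorem sum_negZ_succ_succ_row (hv : ∑ j, v j = 0) (hrow : ∀ i, ∑ j, M₀ i j = 0) (i : Fin (m + 2)) :
    ∑ j : Fin (m + 2), negZ M₀ v w s t (i.succ, j.succ) = ((m : ℝ) + 2) * (w i + s) := by
  simp only [negZ_succ_succ, Finset.sum_add_distrib, hrow i, hv, Finset.sum_const, Finset.card_univ,
    Fintype.card_fin, nsmul_eq_mul]
  push_cast; ring

/-- Inner column sums of a test vector: `(m+2)(v_j + s)`. [cite: Yabe2015, §3.2 (proof of Theorem 1.7)] -/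
private theorem sum_negZ_succ_succ_col (hw : ∑ i, w i = 0) (hcol : ∀ j, ∑ i, M₀ i j = 0) (j : Fin (m + 2)) :
    ∑ i : Fin (m + 2), negZ M₀ v w s t (i.succ, j.succ) = ((m : ℝ) + 2) * (v j + s) := by
  simp only [negZ_succ_succ, Finset.sum_add_distrib, hcol j, hw, Finset.sum_const, Finset.card_univ,
    Fintype.card_fin, nsmul_eq_mul]
  push_cast; ring

/-- Total inner sum of a test vector: `(m+2)² s`. [cite: Yabe2015, §3.2 (proof of Theorem 1.7)] -/
private theorem sum_sum_negZ_succ_succ (hv : ∑ j, v j = 0) (hw : ∑ i, w i = 0)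
    (hrow : ∀ i, ∑ j, M₀ i j = 0) :
    ∑ i : Fin (m + 2), ∑ j : Fin (m + 2), negZ M₀ v w s t (i.succ, j.succ) = ((m : ℝ) + 2) ^ 2 * s := by
  simp_rw [sum_negZ_succ_succ_row hv hrow]
  rw [← Finset.mul_sum, Finset.sum_add_distrib, hw, Finset.sum_const, Finset.card_univ,
    Fintype.card_fin, nsmul_eq_mul]
  push_cast; ring

/-- **`H Z` on the inner block**: `(H Z)(i+1,j+1) = −2 M₀ᵢⱼ − (m+1)(2m+3)s` (`H = mrHess`):
the zero-margin part is an eigenvector with eigenvalue `−2`. [cite: Yabe2015, §3.2 (proof of Theorem 1.7)] -/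
theorem mrHess_mulVec_negZ_succ_succ (hv : ∑ j, v j = 0) (hw : ∑ i, w i = 0)
    (hrow : ∀ i, ∑ j, M₀ i j = 0) (hcol : ∀ j, ∑ i, M₀ i j = 0) (i₀ j₀ : Fin (m + 2)) :
    (mrHess ℝ m *ᵥ negZ M₀ v w s t) (i₀.succ, j₀.succ) =
      -2 * M₀ i₀ j₀ - ((m : ℝ) + 1) * (2 * m + 3) * s := by
  rw [Matrix.mulVec, dotProduct, sum_prod_fin_succ]
  simp only [mrHess_succ_succ_zero_zero, mrHess_succ_succ_zero_succ, mrHess_succ_succ_succ_zero,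
    mrHess_succ_succ_succ_succ]
  rw [sum_ite_eq_zero, sum_ite_eq_zero, sum_sum_ite_or_eq_zero, sum_negZ_zero_succ hv,
    sum_negZ_succ_zero hw, sum_sum_negZ_succ_succ hv hw hrow,
    sum_negZ_succ_succ_row hv hrow, sum_negZ_succ_succ_col hw hcol]
  simp only [negZ_zero_zero, negZ_zero_succ, negZ_succ_zero, negZ_succ_succ]
  ring

/-- **`H Z` on row `0`**: `(H Z)(0,j+1) = (m+1)(m+2)(−v_j + (m+1)s − t)`. [cite: Yabe2015, §3.2 (proof of Theorem 1.7)] -/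
theorem mrHess_mulVec_negZ_zero_succ (hv : ∑ j, v j = 0) (hw : ∑ i, w i = 0)
    (hrow : ∀ i, ∑ j, M₀ i j = 0) (hcol : ∀ j, ∑ i, M₀ i j = 0) (j₀ : Fin (m + 2)) :
    (mrHess ℝ m *ᵥ negZ M₀ v w s t) (0, j₀.succ) =
      ((m : ℝ) + 1) * ((m : ℝ) + 2) * (-v j₀ + ((m : ℝ) + 1) * s - t) := by
  rw [Matrix.mulVec, dotProduct, sum_prod_fin_succ]
  simp only [mrHess_zero_succ_zero_zero, mrHess_zero_succ_zero_succ, mrHess_zero_succ_succ_zero,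
    mrHess_zero_succ_succ_succ, zero_mul, Finset.sum_const_zero, zero_add]
  simp_rw [sum_ite_eq_zero]
  rw [← Finset.mul_sum, sum_negZ_succ_zero hw, Finset.sum_sub_distrib, ← Finset.mul_sum,
    ← Finset.mul_sum, sum_sum_negZ_succ_succ hv hw hrow, sum_negZ_succ_succ_col hw hcol]
  ring

/-- **`H Z` on column `0`**: `(H Z)(i+1,0) = (m+1)(m+2)(−w_i + (m+1)s + t)`. [cite: Yabe2015, §3.2 (proof of Theorem 1.7)] -/
theorem mrHess_mulVec_negZ_succ_zero (hv : ∑ j, v j = 0) (hw : ∑ i, w i = 0)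
    (hrow : ∀ i, ∑ j, M₀ i j = 0) (i₀ : Fin (m + 2)) :
    (mrHess ℝ m *ᵥ negZ M₀ v w s t) (i₀.succ, 0) =
      ((m : ℝ) + 1) * ((m : ℝ) + 2) * (-w i₀ + ((m : ℝ) + 1) * s + t) := by
  rw [Matrix.mulVec, dotProduct, sum_prod_fin_succ]
  simp only [mrHess_succ_zero_zero_zero, mrHess_succ_zero_zero_succ, mrHess_succ_zero_succ_zero,
    mrHess_succ_zero_succ_succ, zero_mul, Finset.sum_const_zero, add_zero, zero_add]
  have h : ∀ i : Fin (m + 2), ∑ j : Fin (m + 2), (if i = i₀ then (0 : ℝ) else (m : ℝ) + 1) *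
      negZ M₀ v w s t (i.succ, j.succ) =
      (if i = i₀ then 0 else (m : ℝ) + 1) * (((m : ℝ) + 2) * (w i + s)) := by
    intro i; rw [← Finset.mul_sum, sum_negZ_succ_succ_row hv hrow]
  simp_rw [h]
  rw [← Finset.mul_sum, sum_negZ_zero_succ hv, sum_ite_eq_zero]
  have h2 : ∑ i : Fin (m + 2), ((m : ℝ) + 2) * (w i + s) = ((m : ℝ) + 2) * (((m : ℝ) + 2) * s) := by
    rw [← Finset.mul_sum, Finset.sum_add_distrib, hw, Finset.sum_const, Finset.card_univ,
      Fintype.card_fin, nsmul_eq_mul]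
    push_cast; ring
  rw [h2]
  ring

/-- **`H Z` at `(0,0)`**: `(H Z)(0,0) = (m+1)(m+2)² s`. [cite: Yabe2015, §3.2 (proof of Theorem 1.7)] -/
theorem mrHess_mulVec_negZ_zero_zero (hv : ∑ j, v j = 0) (hw : ∑ i, w i = 0)
    (hrow : ∀ i, ∑ j, M₀ i j = 0) :
    (mrHess ℝ m *ᵥ negZ M₀ v w s t) (0, 0) = ((m : ℝ) + 1) * ((m : ℝ) + 2) ^ 2 * s := by
  rw [Matrix.mulVec, dotProduct, sum_prod_fin_succ]
  simp only [mrHess_zero_zero_zero_zero, mrHess_zero_zero_zero_succ, mrHess_zero_zero_succ_zero,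
    mrHess_zero_zero_succ_succ, zero_mul, Finset.sum_const_zero, add_zero, zero_add]
  simp_rw [← Finset.mul_sum]
  rw [sum_sum_negZ_succ_succ hv hw hrow]
  ring

end MulVec

/-! #### The quadratic form on the test vectors -/

/-- **The Hessian form on the test vectors is a negative sum of squares**:
`Zᵀ·mrHess·Z = −2‖M₀‖² − 2(m+1)(m+2)(‖v‖² + ‖w‖²) − 2(m+1)(m+2)³ s² − 2(m+1)(m+2)² t²`
(for `M₀` with zero row and column sums and `Σv = Σw = 0`). This is the explicit form of the count
`n₋(H_{per_d,Σ_d}) = (d−1)² + 1` of Yabe 2015, §3.2 (there obtained from the congruence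
`T H Tᵀ = diag(S_{d−1} ⊗ B, −((d−1)/(d−2)) C B⁻¹ C)`); cross-checked in exact arithmetic for
`d = 3,…,6` before formalisation. [cite: Yabe2015, §3.2 (proof of Theorem 1.7)] -/
theorem negZ_dotProduct_mrHess_mulVec_negZ {M₀ : Fin (m + 2) → Fin (m + 2) → ℝ}
    {v w : Fin (m + 2) → ℝ} {s t : ℝ} (hv : ∑ j, v j = 0) (hw : ∑ i, w i = 0)
    (hrow : ∀ i, ∑ j, M₀ i j = 0) (hcol : ∀ j, ∑ i, M₀ i j = 0) :
    negZ M₀ v w s t ⬝ᵥ (mrHess ℝ m *ᵥ negZ M₀ v w s t) =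
      -2 * ∑ i, ∑ j, M₀ i j ^ 2 - 2 * ((m : ℝ) + 1) * ((m : ℝ) + 2) * (∑ j, v j ^ 2 + ∑ i, w i ^ 2)
        - 2 * ((m : ℝ) + 1) * ((m : ℝ) + 2) ^ 3 * s ^ 2 - 2 * ((m : ℝ) + 1) * ((m : ℝ) + 2) ^ 2 * t ^ 2 := by
  rw [dotProduct, sum_prod_fin_succ]
  simp_rw [mrHess_mulVec_negZ_zero_zero hv hw hrow, mrHess_mulVec_negZ_zero_succ hv hw hrow hcol,
    mrHess_mulVec_negZ_succ_zero hv hw hrow, mrHess_mulVec_negZ_succ_succ hv hw hrow hcol,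
    negZ_zero_zero, negZ_zero_succ, negZ_succ_zero, negZ_succ_succ]
  set A : ℝ := ((m : ℝ) + 1) * s with hA
  set c : ℝ := ((m : ℝ) + 1) * ((m : ℝ) + 2) with hc
  set B : ℝ := ((m : ℝ) + 1) * (2 * m + 3) * s with hB
  have hcard : (Finset.univ : Finset (Fin (m + 2))).card = m + 2 := by simp
  -- row `0`
  have h0j : ∑ j : Fin (m + 2), (2 * v j + t) * (c * (-v j + A - t)) =
      c * (-2 * ∑ j, v j ^ 2) + c * (((m : ℝ) + 2) * (t * (A - t))) := by
    have h : ∀ j, (2 * v j + t) * (c * (-v j + A - t)) =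
        c * (-2) * v j ^ 2 + c * (2 * (A - t) - t) * v j + c * (t * (A - t)) := by intro j; ring
    simp_rw [h]
    rw [Finset.sum_add_distrib, Finset.sum_add_distrib, ← Finset.mul_sum, ← Finset.mul_sum, hv,
      Finset.sum_const, hcard, nsmul_eq_mul]
    push_cast; ring
  -- column `0`
  have hi0 : ∑ i : Fin (m + 2), (2 * w i - t) * (c * (-w i + A + t)) =
      c * (-2 * ∑ i, w i ^ 2) - c * (((m : ℝ) + 2) * (t * (A + t))) := by
    have h : ∀ i, (2 * w i - t) * (c * (-w i + A + t)) =
        c * (-2) * w i ^ 2 + c * (2 * (A + t) + t) * w i - c * (t * (A + t)) := by intro i; ring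
    simp_rw [h]
    rw [Finset.sum_sub_distrib, Finset.sum_add_distrib, ← Finset.mul_sum, ← Finset.mul_sum, hw,
      Finset.sum_const, hcard, nsmul_eq_mul]
    push_cast; ring
  -- inner block
  have hij : ∑ i : Fin (m + 2), ∑ j : Fin (m + 2), (M₀ i j + v j + w i + s) * (-2 * M₀ i j - B) =
      -2 * ∑ i, ∑ j, M₀ i j ^ 2 - B * (((m : ℝ) + 2) ^ 2 * s) := by
    have h : ∀ i j, (M₀ i j + v j + w i + s) * (-2 * M₀ i j - B) =
        -2 * M₀ i j ^ 2 + M₀ i j * (-2 * v j) + M₀ i j * (-2 * w i - 2 * s - B)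
          - B * (v j + w i + s) := by intro i j; ring
    simp_rw [h]
    simp only [Finset.sum_add_distrib, Finset.sum_sub_distrib]
    have h1 : ∑ i : Fin (m + 2), ∑ j : Fin (m + 2), M₀ i j * (-2 * v j) = 0 := by
      rw [Finset.sum_comm]
      refine Finset.sum_eq_zero fun j _ => ?_
      rw [← Finset.sum_mul, hcol j, zero_mul]
    have h2 : ∑ i : Fin (m + 2), ∑ j : Fin (m + 2), M₀ i j * (-2 * w i - 2 * s - B) = 0 := by
      refine Finset.sum_eq_zero fun i _ => ?_
      rw [← Finset.sum_mul, hrow i, zero_mul]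
    have h3 : ∑ i : Fin (m + 2), ∑ j : Fin (m + 2), B * (v j + w i + s) = B * (((m : ℝ) + 2) ^ 2 * s) := by
      have h4 : ∀ i : Fin (m + 2), ∑ j : Fin (m + 2), B * (v j + w i + s) =
          B * (((m : ℝ) + 2) * (w i + s)) := by
        intro i
        rw [← Finset.mul_sum, Finset.sum_add_distrib, Finset.sum_add_distrib, hv, Finset.sum_const,
          Finset.sum_const, hcard, nsmul_eq_mul, nsmul_eq_mul]
        push_cast; ring
      simp_rw [h4]
      rw [← Finset.mul_sum, ← Finset.mul_sum, Finset.sum_add_distrib, hw, Finset.sum_const, hcard,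
        nsmul_eq_mul]
      push_cast; ring
    rw [h1, h2, h3]
    have h5 : ∑ i : Fin (m + 2), ∑ j : Fin (m + 2), -2 * M₀ i j ^ 2 = -2 * ∑ i, ∑ j, M₀ i j ^ 2 := by
      rw [Finset.mul_sum]
      exact Finset.sum_congr rfl fun i _ => by rw [Finset.mul_sum]
    rw [h5]
    ring
  rw [h0j, hi0, hij, hA, hB, hc]
  ring




/-! #### Linearity of the test vectors and the padded parametrisation -/

section Frame

/-- The test vectors depend additively on the data. [cite: Yabe2015, §3.2 (proof of Theorem 1.7)] -/
private theorem negZ_add (M₀ M₀' : Fin (m + 2) → Fin (m + 2) → ℝ) (v v' w w' : Fin (m + 2) → ℝ)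
    (s s' t t' : ℝ) :
    negZ (M₀ + M₀') (v + v') (w + w') (s + s') (t + t') = negZ M₀ v w s t + negZ M₀' v' w' s' t' := by
  funext p
  obtain ⟨a, b⟩ := p
  refine Fin.cases ?_ (fun i => ?_) a <;> refine Fin.cases ?_ (fun j => ?_) b <;>
    simp [negZ] <;> ring

/-- The test vectors depend homogeneously on the data. [cite: Yabe2015, §3.2 (proof of Theorem 1.7)] -/
private theorem negZ_smul (r : ℝ) (M₀ : Fin (m + 2) → Fin (m + 2) → ℝ) (v w : Fin (m + 2) → ℝ) (s t : ℝ) :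
    negZ (r • M₀) (r • v) (r • w) (r * s) (r * t) = r • negZ M₀ v w s t := by
  funext p
  obtain ⟨a, b⟩ := p
  refine Fin.cases ?_ (fun i => ?_) a <;> refine Fin.cases ?_ (fun j => ?_) b <;>
    simp [negZ] <;> ring

/-- Pad a vector in `ℝ^{m+1}` by minus its sum: a parametrisation of `{v ∈ ℝ^{m+2} | Σ v = 0}`
(plumbing for the frame below). [folklore] -/
def padVec (v' : Fin (m + 1) → ℝ) : Fin (m + 2) → ℝ := Fin.snoc v' (-∑ i, v' i)

/-- The first `m+1` coordinates of a padded vector. [folklore] -/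
@[simp] private theorem padVec_castSucc (v' : Fin (m + 1) → ℝ) (i : Fin (m + 1)) :
    padVec v' i.castSucc = v' i := by simp [padVec]
/-- The last coordinate of a padded vector. [folklore] -/
@[simp] private theorem padVec_last (v' : Fin (m + 1) → ℝ) : padVec v' (Fin.last (m + 1)) = -∑ i, v' i := by
  simp [padVec]

/-- A padded vector sums to zero. [folklore] -/
private theorem sum_padVec (v' : Fin (m + 1) → ℝ) : ∑ j, padVec v' j = 0 := by
  rw [Fin.sum_univ_castSucc]; simp

/-- Padding is additive. [folklore] -/
private theorem padVec_add (v₁ v₂ : Fin (m + 1) → ℝ) : padVec (v₁ + v₂) = padVec v₁ + padVec v₂ := by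
  funext j
  refine Fin.lastCases ?_ (fun i => ?_) j
  · simp [Finset.sum_add_distrib]; ring
  · simp

/-- Padding is homogeneous. [folklore] -/
private theorem padVec_smul (r : ℝ) (v' : Fin (m + 1) → ℝ) : padVec (r • v') = r • padVec v' := by
  funext j
  refine Fin.lastCases ?_ (fun i => ?_) j
  · simp [Finset.mul_sum]
  · simp

/-- Padding is injective. [folklore] -/
private theorem padVec_eq_zero {v' : Fin (m + 1) → ℝ} (h : padVec v' = 0) : v' = 0 := by
  funext i
  have := congrFun h i.castSucc
  simpa using this

/-- Pad an `(m+1) × (m+1)` block to an `(m+2) × (m+2)` block with zero row and column sums: a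
parametrisation of the zero-margin matrices (plumbing for the frame below). [folklore] -/
def padMat (K : Fin (m + 1) → Fin (m + 1) → ℝ) : Fin (m + 2) → Fin (m + 2) → ℝ :=
  Fin.snoc (fun i => padVec (K i)) (fun j => -∑ i, padVec (K i) j)

/-- The first `m+1` rows of a padded block. [folklore] -/
@[simp] private theorem padMat_castSucc (K : Fin (m + 1) → Fin (m + 1) → ℝ) (i : Fin (m + 1)) :
    padMat K i.castSucc = padVec (K i) := by simp [padMat]
/-- The last row of a padded block. [folklore] -/
@[simp] private theorem padMat_last (K : Fin (m + 1) → Fin (m + 1) → ℝ) (j : Fin (m + 2)) :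
    padMat K (Fin.last (m + 1)) j = -∑ i, padVec (K i) j := by simp [padMat]

/-- Padded blocks have zero row sums. [folklore] -/
private theorem sum_padMat_row (K : Fin (m + 1) → Fin (m + 1) → ℝ) (i : Fin (m + 2)) :
    ∑ j, padMat K i j = 0 := by
  refine Fin.lastCases ?_ (fun i' => ?_) i
  · simp only [padMat_last, Finset.sum_neg_distrib, neg_eq_zero]
    rw [Finset.sum_comm]
    exact Finset.sum_eq_zero fun i _ => sum_padVec _
  · rw [padMat_castSucc]; exact sum_padVec _

/-- Padded blocks have zero column sums. [folklore] -/
private theorem sum_padMat_col (K : Fin (m + 1) → Fin (m + 1) → ℝ) (j : Fin (m + 2)) :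
    ∑ i, padMat K i j = 0 := by
  rw [Fin.sum_univ_castSucc]; simp

/-- Block padding is additive. [folklore] -/
private theorem padMat_add (K₁ K₂ : Fin (m + 1) → Fin (m + 1) → ℝ) : padMat (K₁ + K₂) = padMat K₁ + padMat K₂ := by
  funext i j
  refine Fin.lastCases ?_ (fun i' => ?_) i
  · simp [padVec_add, Finset.sum_add_distrib]; ring
  · simp [padVec_add]

/-- Block padding is homogeneous. [folklore] -/
private theorem padMat_smul (r : ℝ) (K : Fin (m + 1) → Fin (m + 1) → ℝ) : padMat (r • K) = r • padMat K := by
  funext i j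
  refine Fin.lastCases ?_ (fun i' => ?_) i
  · simp [padVec_smul, Finset.mul_sum]
  · simp [padVec_smul]

/-- Block padding is injective. [folklore] -/
private theorem padMat_eq_zero {K : Fin (m + 1) → Fin (m + 1) → ℝ} (h : padMat K = 0) : K = 0 := by
  funext i j
  have := congrFun (congrFun h i.castSucc) j.castSucc
  simpa using this

/-- Parameter type of the frame: `|κ| = (m+1)² + 2(m+1) + 2 = (m+2)² + 1 = (d−1)² + 1` (plumbing).
[folklore] -/
abbrev FrameIdx (m : ℕ) : Type := (Fin (m + 1) × Fin (m + 1)) ⊕ (Fin (m + 1) ⊕ (Fin (m + 1) ⊕ Fin 2))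

/-- `|κ| = (m+2)² + 1`. [folklore] -/
private theorem card_frameIdx : Fintype.card (FrameIdx m) = (m + 2) ^ 2 + 1 := by
  simp [FrameIdx, Fintype.card_sum, Fintype.card_prod]; ring

/-- The frame on coordinates: `c ↦ Z(pad K, pad v', pad w', s, t)` (plumbing). [folklore] -/
def frameFun (c : FrameIdx m → ℝ) : Fin (m + 3) × Fin (m + 3) → ℝ :=
  negZ (padMat fun i j => c (Sum.inl (i, j))) (padVec fun i => c (Sum.inr (Sum.inl i)))
    (padVec fun i => c (Sum.inr (Sum.inr (Sum.inl i)))) (c (Sum.inr (Sum.inr (Sum.inr 0))))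
    (c (Sum.inr (Sum.inr (Sum.inr 1))))

/-- The frame as a linear map `ℝ^κ → ℝ^{d×d}` (plumbing). [folklore] -/
def frameLin : (FrameIdx m → ℝ) →ₗ[ℝ] (Fin (m + 3) × Fin (m + 3) → ℝ) where
  toFun := frameFun
  map_add' c c' := by
    simp only [frameFun]
    rw [← negZ_add, ← padMat_add, ← padVec_add, ← padVec_add]
    rfl
  map_smul' r c := by
    simp only [frameFun, RingHom.id_apply]
    rw [← negZ_smul, ← padMat_smul, ← padVec_smul, ← padVec_smul]
    rfl

/-- Unfolding lemma for `frameLin`. [folklore] -/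
private theorem frameLin_apply (c : FrameIdx m → ℝ) : frameLin c = frameFun c := rfl

/-- **The Hessian form is negative definite on the frame**: `(Vc)ᵀ·mrHess·(Vc) < 0` for `c ≠ 0`
(the sum of squares of `negZ_dotProduct_mrHess_mulVec_negZ` vanishes only if all data vanish, and the
padding maps are injective). [cite: Yabe2015, §3.2 (proof of Theorem 1.7)] -/
theorem frame_neg (c : FrameIdx m → ℝ) (hc : c ≠ 0) :
    frameFun c ⬝ᵥ (mrHess ℝ m *ᵥ frameFun c) < 0 := by
  set K : Fin (m + 1) → Fin (m + 1) → ℝ := fun i j => c (Sum.inl (i, j)) with hK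
  set v' : Fin (m + 1) → ℝ := fun i => c (Sum.inr (Sum.inl i)) with hv'
  set w' : Fin (m + 1) → ℝ := fun i => c (Sum.inr (Sum.inr (Sum.inl i))) with hw'
  set s : ℝ := c (Sum.inr (Sum.inr (Sum.inr 0))) with hs
  set t : ℝ := c (Sum.inr (Sum.inr (Sum.inr 1))) with ht
  have hq := negZ_dotProduct_mrHess_mulVec_negZ (M₀ := padMat K) (v := padVec v') (w := padVec w')
    (s := s) (t := t) (sum_padVec v') (sum_padVec w') (sum_padMat_row K) (sum_padMat_col K)
  change negZ (padMat K) (padVec v') (padVec w') s t ⬝ᵥ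
    (mrHess ℝ m *ᵥ negZ (padMat K) (padVec v') (padVec w') s t) < 0
  rw [hq]
  -- the positive quantity
  have hm1 : (0 : ℝ) < (m : ℝ) + 1 := by positivity
  have hm2 : (0 : ℝ) < (m : ℝ) + 2 := by positivity
  have hM : 0 ≤ ∑ i, ∑ j, padMat K i j ^ 2 := Finset.sum_nonneg fun i _ =>
    Finset.sum_nonneg fun j _ => sq_nonneg _
  have hv : 0 ≤ ∑ j, padVec v' j ^ 2 := Finset.sum_nonneg fun j _ => sq_nonneg _
  have hw : 0 ≤ ∑ i, padVec w' i ^ 2 := Finset.sum_nonneg fun i _ => sq_nonneg _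
  set P1 := ∑ i, ∑ j, padMat K i j ^ 2 with hP1
  set P2 := ∑ j, padVec v' j ^ 2 with hP2
  set P3 := ∑ i, padVec w' i ^ 2 with hP3
  have hab : 0 < ((m : ℝ) + 1) * ((m : ℝ) + 2) := by positivity
  have e1 : 0 ≤ ((m : ℝ) + 1) * ((m : ℝ) + 2) * (P2 + P3) := mul_nonneg hab.le (add_nonneg hv hw)
  have e2 : 0 ≤ ((m : ℝ) + 1) * ((m : ℝ) + 2) ^ 3 * s ^ 2 := by positivity
  have e3 : 0 ≤ ((m : ℝ) + 1) * ((m : ℝ) + 2) ^ 2 * t ^ 2 := by positivity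
  by_contra hge
  rw [not_lt] at hge
  have hT0 : P1 = 0 := by linarith
  have hT1 : ((m : ℝ) + 1) * ((m : ℝ) + 2) * (P2 + P3) = 0 := by linarith
  have hT2 : ((m : ℝ) + 1) * ((m : ℝ) + 2) ^ 3 * s ^ 2 = 0 := by linarith
  have hT3 : ((m : ℝ) + 1) * ((m : ℝ) + 2) ^ 2 * t ^ 2 = 0 := by linarith
  have h23 : P2 + P3 = 0 := (mul_eq_zero.1 hT1).resolve_left hab.ne'
  have hM0 : ∑ i, ∑ j, padMat K i j ^ 2 = 0 := hT0
  have hv0 : ∑ j, padVec v' j ^ 2 = 0 := by change P2 = 0; linarith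
  have hw0 : ∑ i, padVec w' i ^ 2 = 0 := by change P3 = 0; linarith
  have hs0 : s = 0 := by
    have h := (mul_eq_zero.1 hT2).resolve_left (by positivity)
    exact pow_eq_zero_iff (n := 2) (by norm_num) |>.1 h
  have ht0 : t = 0 := by
    have h := (mul_eq_zero.1 hT3).resolve_left (by positivity)
    exact pow_eq_zero_iff (n := 2) (by norm_num) |>.1 h
  have hK0 : K = 0 := by
    refine padMat_eq_zero (funext fun i => funext fun j => ?_)
    have hi := (Finset.sum_eq_zero_iff_of_nonneg fun i _ =>
      Finset.sum_nonneg fun j _ => sq_nonneg (padMat K i j)).1 hM0 i (Finset.mem_univ _)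
    have hij := (Finset.sum_eq_zero_iff_of_nonneg fun j _ => sq_nonneg (padMat K i j)).1 hi j
      (Finset.mem_univ _)
    simpa using hij
  have hv0' : v' = 0 := by
    refine padVec_eq_zero (funext fun j => ?_)
    have := (Finset.sum_eq_zero_iff_of_nonneg fun j _ => sq_nonneg (padVec v' j)).1 hv0 j
      (Finset.mem_univ _)
    simpa using this
  have hw0' : w' = 0 := by
    refine padVec_eq_zero (funext fun i => ?_)
    have := (Finset.sum_eq_zero_iff_of_nonneg fun i _ => sq_nonneg (padVec w' i)).1 hw0 i
      (Finset.mem_univ _)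
    simpa using this
  apply hc
  funext x
  rcases x with ⟨i, j⟩ | i | i | b
  · exact congrFun (congrFun hK0 i) j
  · exact congrFun hv0' i
  · exact congrFun hw0' i
  · fin_cases b
    · exact hs0
    · exact ht0

end Frame

/-! #### Counting negative eigenvalues and the discharge of Theorem 1.7 -/

/-- **`n₋(a·mrHess) ≥ (m+2)² + 1` for `a > 0`** — the inequality half of Yabe 2015, §3.2
"`n₋ = (d−1)² + 1`" (`d = m+3`) for the Hessian `m!·mrHess` of `per_d` at the Mignon–Ressayre point:
Courant–Fischer counting (`Literature.Analysis.Matrix.EigenvalueCount.card_le_card_eigenvalues_lt`, the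
tree's form of Horn–Johnson (4.2.12)) applied to the negative-definite frame `frameLin` of rank
`(m+2)² + 1`. Stated for any `W = a·mrHess` so that it applies verbatim to the Hessian matrix.
[cite: Yabe2015, §3.2 (proof of Theorem 1.7)] -/
theorem card_neg_eigenvalues_smul_mrHess
    {W : Matrix (Fin (m + 3) × Fin (m + 3)) (Fin (m + 3) × Fin (m + 3)) ℝ} {a : ℝ} (ha : 0 < a)
    (hWeq : W = a • mrHess ℝ m) (hW : W.IsHermitian) :
    (m + 2) ^ 2 + 1 ≤ (Finset.univ.filter fun i => hW.eigenvalues i < 0).card := by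
  have h := Literature.Analysis.Matrix.EigenvalueCount.card_le_card_eigenvalues_lt hW
    (LinearMap.toMatrix' (frameLin (m := m))) (θ := 0) (fun c hc => by
      rw [zero_mul, ← Matrix.toLin'_apply (LinearMap.toMatrix' frameLin) c, Matrix.toLin'_toMatrix',
        frameLin_apply, hWeq, Matrix.smul_mulVec, dotProduct_smul, smul_eq_mul]
      exact mul_neg_of_pos_of_neg ha (frame_neg c hc))
  rwa [card_frameIdx] at h

end YabeReal

/-- The Hessian MATRIX (`hessianMatrix`, `HessianRank.lean`) of `per_{m+3}` at the Mignon–Ressayre point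
`mrPoint` is `m! · mrHess` — the tree's `hess0_transl_mrPoint_perPoly` (`MignonRessayreBound.lean`,
Landsberg 2017, (6.4.3)) transported along `hess0 ∘ transl = hessianMatrix` (`hess0_transl`). [cite: LandsbergGCT2017, (6.4.3)] -/
theorem hessianMatrix_perPoly_mrPoint (m : ℕ) :
    hessianMatrix (perPoly (Fin (m + 3)) ℝ) (mrPoint ℝ m) = (m.factorial : ℝ) • mrHess ℝ m := by
  ext s t
  rw [hessianMatrix_apply, ← hess0_transl, hess0_transl_mrPoint_perPoly]

/-- **Discharge of `yabe2015_thm_1_7`** (Yabe 2015, Theorem 1.7, p0003; proof §3.2, p0008–p0009):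
over `ℝ`, `(d−1)² + 1 ≤ dc(per_d)` for every `d ≥ 1`. For `d = 1, 2` this is the degree bound
`d ≤ dc(per_d)` (`card_le_determinantalComplexity_perPoly`). For `d = m+3`: the Mignon–Ressayre point
`Σ_d = mrPoint ℝ m` is a zero of `per_d` (`eval_mrPoint_perPoly`); by Yabe's signature engine
(`yabe2015_signature_le_determinantalComplexity`, the tree's proof of "`dc ≥ brank ≥ rank Q_opt ≥ n₋`")
`dc(per_d) ≥ n₋(H_{per_d,Σ_d})`; and `H_{per_d,Σ_d} = m!·mrHess` (`hessianMatrix_perPoly_mrPoint`) has at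
least `(m+2)² + 1 = (d−1)² + 1` negative eigenvalues (`YabeReal.card_neg_eigenvalues_smul_mrHess`, an
explicit negative-definite subspace replacing the printed congruence computation of the signature
`(2d−2, (d−1)²+1, 0)`). This is, over `ℝ`, a kernel-checked improvement of the Mignon–Ressayre bound
`d²/2`; it says nothing about `dc` over `ℂ` and nothing about `VP ≠ VNP`. [cite: Yabe2015, Theorem 1.7] -/
theorem yabe2015_thm_1_7_holds : yabe2015_thm_1_7 := by
  intro d hd
  rcases Nat.lt_or_ge d 3 with hlt | hge
  · have hdeg := card_le_determinantalComplexity_perPoly (Fin d) ℝ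
    rw [Fintype.card_fin] at hdeg
    interval_cases d
    · simpa using hdeg
    · have : (2 - 1) ^ 2 + 1 = 2 := by norm_num
      rw [this]; exact hdeg
  · obtain ⟨m, rfl⟩ : ∃ m, d = m + 3 := ⟨d - 3, by omega⟩
    have hx : eval (mrPoint ℝ m) (perPoly (Fin (m + 3)) ℝ) = 0 := eval_mrPoint_perPoly
    have hH : (hessianMatrix (perPoly (Fin (m + 3)) ℝ) (mrPoint ℝ m)).IsHermitian :=
      isHermitian_hessianMatrix _ _
    have hfac : (0 : ℝ) < (m.factorial : ℝ) := by exact_mod_cast m.factorial_pos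
    have hcount := YabeReal.card_neg_eigenvalues_smul_mrHess hfac (hessianMatrix_perPoly_mrPoint m) hH
    have hsig := yabe2015_signature_le_determinantalComplexity (perPoly (Fin (m + 3)) ℝ) (mrPoint ℝ m)
      hx hH
    have h : (m + 2) ^ 2 + 1 ≤ determinantalComplexity (perPoly (Fin (m + 3)) ℝ) :=
      hcount.trans ((le_max_right _ _).trans hsig)
    have h' : m + 3 - 1 = m + 2 := by omega
    rw [h']
    exact h

end Literature.Computability.AlgebraicComplexity
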